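import Literature.Probability.Percolation.HalfPlaneArmEvents
import Literature.Probability.Percolation.TriUQuad
import HarnessLib

/-!
# Half-plane arm events are crossings of the U-shaped half-annulus; colour switching for two arms

Topic `Literature/Probability/Percolation`; family `crit-perc`, statement **crit-perc.S16**
(`Literature.Probability.Percolation.triTheta_exponent`). PROOFS ONLY. The arm events confined to
the upper half-plane `ℍ` (`domArmEvent κ m n upperHalfPlane`, `HalfPlaneArmEvents.lean`: Nolin's
`B_{j,σ}(m, n)`, arms from `∂Λ_m` to `∂Λ_n` staying in `ℍ`) are compared with the crossing events
of the U-shaped half-annulus `U_{k,N} = Q_N ∖ I_k°` of `TriUQuad.lean` (`k = m + 1`,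
`N = (n - 1)/2`): every arm contains, after its last visit to the inner half-box
`I_k° = [-m, m] × [0, m] ⊇ Λ_m ∩ ℍ` and before its first exit from the half-box
`Q_N = [-N, N] × [0, N] ⊆ Λ_n`, a crossing of `U_{k,N}` from the inner boundary to the outer
boundary, of the same colour (`exists_uCross_of_arm`); disjoint arms give disjoint crossings.
Hence (`domArmEvent_two_subset_uTwoOpen`, `domArmEvent_subset_uOpen_inter_uClosed`) and, by the
colour switching of `TriUQuad.lean` at `p = 1/2` (`real_uTwoOpen_le`):

* `real_domArmEvent_mono_le` — **the monochromatic half-plane two-arm probability is dominated by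
  a bichromatic crossing probability**: for every colour pair `κ`,
  `P_{1/2}(B_{2,κ}(m, n)) ≤ P_{1/2}(U_{m+1,(n-1)/2}` has an open and a closed inner–outer crossing`)`
  (Nolin 2008, Thm. 24 (i): the half-plane two-arm exponent is the same "for any `σ ∈ 𝔖₂`", by
  the colour-switching argument of Aizenman–Duplantier–Aharony; here the inequality needed for the
  upper bound of the tree's `Nolin2008_halfPlane_twoArm` in the monochromatic cases).

## References

* P. Nolin, Near-critical percolation in two dimensions, *Electron. J. Probab.* 13 (2008), §4.6
  and Thm. 24 (i) [arXiv 0711.4948: Thm. 23 (i)] [Nolin2008].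
* W. Werner, *Lectures on two-dimensional critical percolation*, IAS/Park City Math. Ser. 16
  (2009), first exercise sheet ("Color switching"; "Other half-plane estimates": "the two-arm
  exponent in the half-plane, combined with color switching and the BK inequality") [WernerPCMI2009].
* M. Aizenman, B. Duplantier, A. Aharony, *Phys. Rev. Lett.* 83 (1999) 1359.

## Mathlib / tree

Tree: `domArmEvent`, `upperHalfPlane`, `IsColouredPath` (`HalfPlaneArmEvents.lean`,
`ArmEvents.lean`), `uQuad`, `uSites`, `uInner`, `uL`, `uR`, `real_uTwoOpen_le` (`TriUQuad.lean`),
`TriQuad.twoOpen`, `TriQuad.LRPath` (`TriLowestCrossingSwitch.lean`), `PathIn.of_walk`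
(`OneArmLSW.lean`), `PathIn.last_exit`, `PathIn.exit` (`SitePaths.lean`), `triNorm_le_iff`,
`triGraph_adj_coord`, `sitePercolation_real_preimage_compl`.
-/

noncomputable section

open MeasureTheory Set

namespace Literature.Probability.Percolation

open LatticeModels

variable {m n : ℕ}

/-! ### Each half-plane arm crosses the U-shaped half-annulus -/

/-- **A half-plane arm contains a crossing of the U-shaped half-annulus.** Let `1 ≤ m`,
`k = m + 1`, `N ≥ k + 1` with `2N + 1 ≤ n`. A `𝕋`-path inside `S ∩ ℍ` from a site of `∂Λ_m` to a
site of `∂Λ_n` contains a sub-path inside `S ∩ U_{k,N}` from the inner boundary `uL k N` to the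
outer boundary `uR k N` (after the last visit to `I_k° ⊇ Λ_m ∩ ℍ`, until the first exit from
`Q_N ⊆ Λ_{n-1}`). [cite: Nolin2008, §4.6 (B_{j,σ}(n, N); arms near a boundary)] -/
theorem exists_uCross_of_arm (hm : 1 ≤ m) {N : ℕ} (hkN : m + 1 + 1 ≤ N) (hNn : 2 * N + 1 ≤ n)
    {S : Set (Site 2)} (hS : S ⊆ upperHalfPlane) {x y : Site 2} (hx : x ∈ triSphere m)
    (hy : y ∈ triSphere n) (hp : PathIn triGraph S x y) :
    ∃ a ∈ uL (m + 1) N, ∃ b ∈ uR (m + 1) N, PathIn triGraph ((↑(uSites (m + 1) N) : Set (Site 2)) ∩ S) a b := by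
  rw [mem_triSphere_iff] at hx hy
  have hx' := triNorm_le_iff.1 hx.le
  have hm' : (1 : ℤ) ≤ m := by exact_mod_cast hm
  have hkN' : (m : ℤ) + 2 ≤ N := by exact_mod_cast hkN
  have hNn' : 2 * (N : ℤ) + 1 ≤ n := by exact_mod_cast hNn
  -- last visit to the inner half-box
  have hxI : x ∈ uInner (m + 1) := by
    rw [mem_uInner, abs_le, abs_le] at *
    have := hS hp.left_mem; rw [mem_upperHalfPlane] at this
    push_cast; omega
  have hyI : y ∉ uInner (m + 1) := by
    intro h; rw [mem_uInner] at h; push_cast at h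
    have := (triNorm_le_iff (x := y) (n := 2 * (m : ℤ))).2
      ⟨by rw [abs_le]; omega, by rw [abs_le]; omega, by rw [abs_le]; omega⟩
    omega
  obtain ⟨a', a, ha'I, ha'S, haI, ha'a, hq⟩ := hp.last_exit hxI hyI
  rw [mem_uInner] at ha'I; push_cast at ha'I
  have h0 := triGraph_adj_coord ha'a 0
  have h1 := triGraph_adj_coord ha'a 1
  -- first exit from the half-box `Q_N`
  set R : Set (Site 2) := {z | -(N : ℤ) ≤ z 0 ∧ z 0 ≤ N ∧ z 1 ≤ N} with hR
  have haR : a ∈ R := ⟨by omega, by omega, by omega⟩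
  have hyR : y ∉ R := by
    intro h
    have hy1 : 0 ≤ y 1 := by have := hS hp.right_mem; rwa [mem_upperHalfPlane] at this
    have h' : -(N : ℤ) ≤ y 0 ∧ y 0 ≤ N ∧ y 1 ≤ N := h
    have := (triNorm_le_iff (x := y) (n := 2 * (N : ℤ))).2
      ⟨by rw [abs_le]; omega, by rw [abs_le]; omega, by rw [abs_le]; omega⟩
    omega
  obtain ⟨b, b', hbR, hb'R, hb'S, hbb', hr⟩ := hq.exit haR hyR
  have hbR' : -(N : ℤ) ≤ b 0 ∧ b 0 ≤ N ∧ b 1 ≤ N := hbR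
  have g0 := triGraph_adj_coord hbb' 0
  have g1 := triGraph_adj_coord hbb' 1
  have hb'1 : 0 ≤ b' 1 := by have := hS hb'S.1; rwa [mem_upperHalfPlane] at this
  -- the sub-path lies in `U`
  have hsub : ∀ z ∈ R ∩ (S \ uInner (m + 1)), z ∈ (↑(uSites (m + 1) N) : Set (Site 2)) ∩ S := by
    rintro z ⟨hzR, hzS, hzI⟩
    have hz1 : 0 ≤ z 1 := by have := hS hzS; rwa [mem_upperHalfPlane] at this
    have hzR' : -(N : ℤ) ≤ z 0 ∧ z 0 ≤ N ∧ z 1 ≤ N := hzR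
    exact ⟨mem_coe_uSites.2 ⟨⟨hzR'.1, hzR'.2.1, hz1, hzR'.2.2⟩, hzI⟩, hzS⟩
  have hpath := hr.mono hsub
  refine ⟨a, ⟨hpath.left_mem.1, a', by rw [mem_uInner]; push_cast; exact ha'I, ha'a⟩, b,
    ⟨hpath.right_mem.1, ?_⟩, hpath⟩
  simp only [hR, mem_setOf_eq, not_and_or, not_le] at hb'R
  omega

/-! ### Arm events and crossings of the U-shaped region -/

section Arms

variable (hm : 1 ≤ m) {N : ℕ} (hkN : m + 1 + 1 ≤ N) (hNn : 2 * N + 1 ≤ n)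
include hm hkN hNn

/-- **Each arm of a half-plane arm event gives a crossing of `U_{m+1,N}` of its colour**, with
sites on the arm. [cite: Nolin2008, §4.6] -/
theorem exists_uCross_of_mem_domArmEvent {j : ℕ} {κ : Fin j → Bool} {ω : SiteConfig (Site 2)}
    (h : ω ∈ domArmEvent κ m n upperHalfPlane) :
    ∃ T : Fin j → Set (Site 2), (Pairwise fun i i' => Disjoint (T i) (T i')) ∧
      ∀ i, (∀ z ∈ T i, (z ∈ ω ↔ κ i = true)) ∧
        ∃ a ∈ uL (m + 1) N, ∃ b ∈ uR (m + 1) N, PathIn triGraph ((↑(uSites (m + 1) N) : Set (Site 2)) ∩ T i) a b := by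
  obtain ⟨x, y, w, hw, hdisj⟩ := h
  refine ⟨fun i => {z | z ∈ (w i).support}, ?_, fun i => ⟨fun z hz => ?_, ?_⟩⟩
  · intro i i' hii'
    have hd' : Disjoint (w i).support.toFinset (w i').support.toFinset := hdisj hii'
    rw [Finset.disjoint_left] at hd'
    exact Set.disjoint_left.2 fun z hz hz' => hd' (List.mem_toFinset.2 hz) (List.mem_toFinset.2 hz')
  · have := (hw i).2.2.2.2 z hz
    simpa using this
  · obtain ⟨hxi, hyi, -, hsupp, -⟩ := hw i
    have hS : {z | z ∈ (w i).support} ⊆ upperHalfPlane := fun z hz => (hsupp z hz).2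
    exact exists_uCross_of_arm hm hkN hNn hS hxi hyi (PathIn.of_walk (w i) fun z hz => hz)

/-- **Two half-plane arms of the same colour give two disjoint open crossings of `U_{m+1,N}`**:
`B_{2,(T,T)}(m, n) ⊆ twoOpen`. [cite: Nolin2008, §4.6] -/
theorem domArmEvent_two_subset_uTwoOpen :
    domArmEvent ![true, true] m n upperHalfPlane ⊆ (uQuad (m + 1) N (by omega) hkN).twoOpen := by
  intro ω hω
  obtain ⟨T, hT, harm⟩ := exists_uCross_of_mem_domArmEvent hm hkN hNn hω
  obtain ⟨hc0, a0, ha0, b0, hb0, hp0⟩ := harm 0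
  obtain ⟨hc1, a1, ha1, b1, hb1, hp1⟩ := harm 1
  refine ⟨T 0, T 1, hT (by decide), fun z hz => (hc0 z hz).2 rfl, fun z hz => (hc1 z hz).2 rfl,
    ⟨a0, ha0, b0, hb0, hp0⟩, ⟨a1, ha1, b1, hb1, hp1⟩⟩

/-- **An open and a closed half-plane arm give an open and a closed crossing of `U_{m+1,N}`.** [cite: Nolin2008, §4.6] -/
theorem domArmEvent_subset_uOpen_inter_uClosed :
    domArmEvent ![true, false] m n upperHalfPlane ⊆
      {ω | ∃ a ∈ uL (m + 1) N, ∃ b ∈ uR (m + 1) N, PathIn triGraph (↑(uSites (m + 1) N) ∩ ω) a b} ∩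
        {ω | ∃ a ∈ uL (m + 1) N, ∃ b ∈ uR (m + 1) N, PathIn triGraph (↑(uSites (m + 1) N) ∩ ωᶜ) a b} := by
  intro ω hω
  obtain ⟨T, -, harm⟩ := exists_uCross_of_mem_domArmEvent hm hkN hNn hω
  obtain ⟨hc0, a0, ha0, b0, hb0, hp0⟩ := harm 0
  obtain ⟨hc1, a1, ha1, b1, hb1, hp1⟩ := harm 1
  refine ⟨⟨a0, ha0, b0, hb0, hp0.mono fun z hz => ⟨hz.1, (hc0 z hz.2).2 rfl⟩⟩,
    ⟨a1, ha1, b1, hb1, hp1.mono fun z hz => ⟨hz.1, fun hzω => ?_⟩⟩⟩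
  have := (hc1 z hz.2).1 hzω
  simp at this

/-- **Two open half-plane arms also give an open and a closed crossing, in probability** (colour
switching in `U_{m+1,N}`, `real_uTwoOpen_le`): `P_{1/2}(B_{2,(T,T)}(m, n)) ≤ P_{1/2}(U_{m+1,N}` has
an open and a closed inner–outer crossing`)`. [cite: Nolin2008, §4.6 with Thm. 24 (i) ("for any σ ∈ 𝔖₂")] [cite: WernerPCMI2009, Lecture 2, first exercise sheet ("Color switching"; "Other half-plane estimates")] -/
theorem real_domArmEvent_two_open_le :
    (triSitePercolation half).real (domArmEvent ![true, true] m n upperHalfPlane) ≤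
      (triSitePercolation half).real
        ({ω | ∃ a ∈ uL (m + 1) N, ∃ b ∈ uR (m + 1) N, PathIn triGraph (↑(uSites (m + 1) N) ∩ ω) a b} ∩
          {ω | ∃ a ∈ uL (m + 1) N, ∃ b ∈ uR (m + 1) N, PathIn triGraph (↑(uSites (m + 1) N) ∩ ωᶜ) a b}) :=
  (measureReal_mono (domArmEvent_two_subset_uTwoOpen hm hkN hNn) (measure_ne_top _ _)).trans
    (real_uTwoOpen_le (by omega) hkN)

/-- The same bound for an open and a closed arm (plain inclusion). [cite: Nolin2008, §4.6] -/
theorem real_domArmEvent_open_closed_le :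
    (triSitePercolation half).real (domArmEvent ![true, false] m n upperHalfPlane) ≤
      (triSitePercolation half).real
        ({ω | ∃ a ∈ uL (m + 1) N, ∃ b ∈ uR (m + 1) N, PathIn triGraph (↑(uSites (m + 1) N) ∩ ω) a b} ∩
          {ω | ∃ a ∈ uL (m + 1) N, ∃ b ∈ uR (m + 1) N, PathIn triGraph (↑(uSites (m + 1) N) ∩ ωᶜ) a b}) :=
  measureReal_mono (domArmEvent_subset_uOpen_inter_uClosed hm hkN hNn) (measure_ne_top _ _)

end Arms

/-! ### Colour exchange and the four colour pairs -/

/-- **Exchanging all colours**: `ω` has arms of colours `κ` iff `ωᶜ` has arms of the complementary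
colours. [cite: Nolin2008, §4.3 (symmetry under colour exchange)] -/
theorem compl_mem_domArmEvent_iff {j : ℕ} (κ : Fin j → Bool) (r R : ℕ) (H : Set (Site 2))
    (ω : SiteConfig (Site 2)) :
    ωᶜ ∈ domArmEvent κ r R H ↔ ω ∈ domArmEvent (fun i => !κ i) r R H := by
  constructor
  · rintro ⟨x, y, w, hw, hd⟩
    refine ⟨x, y, w, fun i => ⟨(hw i).1, (hw i).2.1, (hw i).2.2.1, (hw i).2.2.2.1, fun v hv => ?_⟩, hd⟩
    have := (hw i).2.2.2.2 v hv
    rw [Set.mem_compl_iff] at this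
    cases hκ : κ i <;> simp_all
  · rintro ⟨x, y, w, hw, hd⟩
    refine ⟨x, y, w, fun i => ⟨(hw i).1, (hw i).2.1, (hw i).2.2.1, (hw i).2.2.2.1, fun v hv => ?_⟩, hd⟩
    have := (hw i).2.2.2.2 v hv
    rw [Set.mem_compl_iff]
    cases hκ : κ i <;> simp_all

/-- **Colour exchange preserves `P_{1/2}`** for confined arm events. [cite: Nolin2008, §4.3] -/
theorem real_domArmEvent_not (j : ℕ) (κ : Fin j → Bool) (r R : ℕ) (H : Set (Site 2)) :
    (triSitePercolation half).real (domArmEvent (fun i => !κ i) r R H) =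
      (triSitePercolation half).real (domArmEvent κ r R H) := by
  have hset : domArmEvent (fun i => !κ i) r R H = compl ⁻¹' domArmEvent κ r R H := by
    ext ω; exact (compl_mem_domArmEvent_iff κ r R H ω).symm
  have hs : unitInterval.symm half = half := Subtype.ext (by simp [half]; norm_num)
  rw [hset]
  unfold triSitePercolation
  rw [sitePercolation_real_preimage_compl, hs]

/-- **Swapping the two arms**: the order-free two-arm event is symmetric in its colour pair. [folklore] -/
theorem domArmEvent_two_swap (c c' : Bool) (r R : ℕ) (H : Set (Site 2)) :
    domArmEvent ![c, c'] r R H = domArmEvent ![c', c] r R H := by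
  have key : ∀ c c' : Bool, domArmEvent ![c, c'] r R H ⊆ domArmEvent ![c', c] r R H := by
    intro c c'
    rintro ω ⟨x, y, w, hw, hd⟩
    refine ⟨x ∘ Equiv.swap 0 1, y ∘ Equiv.swap 0 1, fun i => w (Equiv.swap 0 1 i), fun i => ?_, ?_⟩
    · obtain ⟨h1, h2, h3, h4, h5⟩ := hw (Equiv.swap 0 1 i)
      refine ⟨h1, h2, h3, h4, ?_⟩
      fin_cases i <;> simpa using h5
    · intro i i' hii'
      exact hd fun h => hii' ((Equiv.swap 0 1).injective h)
  exact Subset.antisymm (key c c') (key c' c)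

/-- **Every half-plane two-arm probability is dominated by the bichromatic U-crossing
probability** (`1 ≤ m`, `N ≥ m + 2`, `2N + 1 ≤ n`): for every colour pair `κ`,
`P_{1/2}(B_{2,κ}(m, n)) ≤ P_{1/2}(U_{m+1,N}` has an open and a closed inner–outer crossing`)` — for
`κ = (T, F), (F, T)` by inclusion, for `κ = (T, T)` by colour switching, and for `κ = (F, F)` by
colour exchange. [cite: Nolin2008, §4.6 with Thm. 24 (i) ("for any σ ∈ 𝔖₂")] [cite: WernerPCMI2009, Lecture 2, first exercise sheet ("Color switching")] -/
theorem real_domArmEvent_two_le (hm : 1 ≤ m) {N : ℕ} (hkN : m + 1 + 1 ≤ N) (hNn : 2 * N + 1 ≤ n)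
    (κ : Fin 2 → Bool) :
    (triSitePercolation half).real (domArmEvent κ m n upperHalfPlane) ≤
      (triSitePercolation half).real
        ({ω | ∃ a ∈ uL (m + 1) N, ∃ b ∈ uR (m + 1) N, PathIn triGraph (↑(uSites (m + 1) N) ∩ ω) a b} ∩
          {ω | ∃ a ∈ uL (m + 1) N, ∃ b ∈ uR (m + 1) N, PathIn triGraph (↑(uSites (m + 1) N) ∩ ωᶜ) a b}) := by
  have hκ : κ = ![κ 0, κ 1] := by ext i; fin_cases i <;> rfl
  rw [hκ]
  cases h0 : κ 0 <;> cases h1 : κ 1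
  · -- `(F, F)`: colour exchange to `(T, T)`
    have := real_domArmEvent_not 2 ![true, true] m n upperHalfPlane
    have e : (fun i => !(![true, true] : Fin 2 → Bool) i) = ![false, false] := by ext i; fin_cases i <;> rfl
    rw [e] at this
    rw [this]
    exact real_domArmEvent_two_open_le hm hkN hNn
  · rw [domArmEvent_two_swap]
    exact real_domArmEvent_open_closed_le hm hkN hNn
  · exact real_domArmEvent_open_closed_le hm hkN hNn
  · exact real_domArmEvent_two_open_le hm hkN hNn

end Literature.Probability.Percolation
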